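import Literature.RingTheory.FormalGroups.NilpotentEvaluationPairSubst
import Literature.RingTheory.FormalGroups.FormalGroupInverse
import HarnessLib

/-!
# The `F`-addition of nilpotent points: unit, commutativity, inverse, and the action of sums of homomorphisms and of `[m]_F`
# ([Hazewinkel 1978] §1.1–§1.2; P6d points currency (β))

Topic `Literature/RingTheory/FormalGroups`; namespace `Literature.RingTheory.FormalGroups`.  THEOREMS ONLY (no definition, no named fact,
no instance, no notation, no `sorry`).  Cell `hodgecm-mathlib`, P6 «MOD programme» ROW 4B: point-level laws of `x +_F y := evalNilp₂ F x y`
(★ `NilpotentEvaluation`∕`Pair`∕`PairSubst`) read off the SERIES identities of Mathlib `FormalGroup` (`add_zero`, `zero_add`, `comm'`), of ★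
`FormalGroupHomAdd` (`add`, `nsmulHom`) and of ★ `FormalGroupInverse` (`negSeries`).  (Associativity on points needs a three-variable
evaluation and is deliberately NOT here — the P6d dictionary takes it from the group object `B`.)

## Contents

* `evalNilp_subst_pair` — `(G(φ,ψ))(x) = G(φ(x), ψ(x))` for univariate `φ, ψ` without constant term (one-variable target).
* `evalNilp₂_zero_right∕left` — `F(x, 0) = x`, `F(0, y) = y`; `evalNilp₂_comm` — `F(x,y) = F(y,x)` for commutative `F`.
* `evalNilp₂_negSeries_right∕left` — `F(x, ι_F(x)) = 0 = F(ι_F(x), x)` (★ `negSeries`).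
* `FormalGroupHom.evalNilp_add` — `(φ + ψ)(x) = G(φ(x), ψ(x))`; `FormalGroupHom.evalNilp_nsmulHom_succ` — `[m+1]_F(x) = F([m]_F(x), x)`,
  `FormalGroupHom.evalNilp_nsmulHom_zero` — `[0]_F(x) = 0`.
-/

noncomputable section

namespace Literature.RingTheory.FormalGroups

open Finset

universe u v

variable {A : Type u} [CommRing A] {R : Type v} [CommRing R] [Algebra A R]

/-! ## §1 Univariate pairs substituted into a two-variable series -/

/-- **`(G(φ,ψ))(x) = G(φ(x), ψ(x))`** for univariate `φ, ψ` with `φ(0) = ψ(0) = 0` and a nilpotent `x` (one-variable target): reduce to the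
two-variable composition ★ `evalNilp₂_subst_pair` along the diagonal `y := x` is NOT needed — we go through `X₀`-substitution instead:
`G(φ,ψ) = (G(φ(X₀), ψ(X₀)))` read at `(x, x)`. [cite: BourbakiAlgebraII2003, Ch. IV §4 no. 3] -/
theorem evalNilp_subst_pair (G : MvPowerSeries (Fin 2) A) {φ ψ : PowerSeries A} (hφ : PowerSeries.constantCoeff φ = 0)
    (hψ : PowerSeries.constantCoeff ψ = 0) {x : R} (hx : IsNilpotent x) :
    evalNilp (G.subst ![φ, ψ]) x = evalNilp₂ G (evalNilp φ x) (evalNilp ψ x) := by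
  -- `G(φ,ψ)` as a univariate series, substituted at `X₀`, is `G(φ(X₀), ψ(X₀))`
  have hφs : PowerSeries.HasSubst φ := PowerSeries.HasSubst.of_constantCoeff_zero' hφ
  have hψs : PowerSeries.HasSubst ψ := PowerSeries.HasSubst.of_constantCoeff_zero' hψ
  have hX0 : PowerSeries.HasSubst (MvPowerSeries.X 0 : MvPowerSeries (Fin 2) A) := PowerSeries.HasSubst.X 0
  have h1 : PowerSeries.subst (MvPowerSeries.X 0 : MvPowerSeries (Fin 2) A) (G.subst ![φ, ψ]) =
      G.subst ![PowerSeries.subst (MvPowerSeries.X 0 : MvPowerSeries (Fin 2) A) φ,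
        PowerSeries.subst (MvPowerSeries.X 0 : MvPowerSeries (Fin 2) A) ψ] := by
    rw [PowerSeries.subst_def, MvPowerSeries.subst_comp_subst_apply (hasSubst_pair hφs hψs) hX0.const]
    congr 1
    funext s; fin_cases s <;> rfl
  have h0φ : MvPowerSeries.constantCoeff (PowerSeries.subst (MvPowerSeries.X 0 : MvPowerSeries (Fin 2) A) φ) = 0 :=
    PowerSeries.constantCoeff_subst_eq_zero (MvPowerSeries.constantCoeff_X 0) _ hφ
  have h0ψ : MvPowerSeries.constantCoeff (PowerSeries.subst (MvPowerSeries.X 0 : MvPowerSeries (Fin 2) A) ψ) = 0 :=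
    PowerSeries.constantCoeff_subst_eq_zero (MvPowerSeries.constantCoeff_X 0) _ hψ
  rw [← evalNilp₂_powerSeries_subst_X₀ (G.subst ![φ, ψ]) hx hx, h1, evalNilp₂_subst_pair G h0φ h0ψ hx hx,
    evalNilp₂_powerSeries_subst_X₀ φ hx hx, evalNilp₂_powerSeries_subst_X₀ ψ hx hx]

/-! ## §2 Unit, commutativity, inverse on nilpotent points -/

/-- **`F(x, 0) = x`** on nilpotent points (Mathlib `FormalGroup.add_zero`). [cite: Hazewinkel1978, §1.1 Def. (1.1.1)] -/
theorem evalNilp₂_zero_right (F : FormalGroup A) {x : R} (hx : IsNilpotent x) : evalNilp₂ F.toPowerSeries x 0 = x := by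
  have h := F.add_zero (PowerSeries.HasSubst.X (0 : Fin 2))
  -- evaluate `F(X₀, 0) = X₀` at `(x, 0)`
  have hev := congrArg (fun S : MvPowerSeries (Fin 2) A => evalNilp₂ S x (0 : R)) h
  rw [evalNilp₂_subst_pair F.toPowerSeries (MvPowerSeries.constantCoeff_X 0) (map_zero _) hx IsNilpotent.zero,
    evalNilp₂_X₀ hx IsNilpotent.zero, evalNilp₂_zero] at hev
  exact hev

/-- **`F(0, y) = y`** on nilpotent points (Mathlib `FormalGroup.zero_add`). [cite: Hazewinkel1978, §1.1 Def. (1.1.1)] -/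
theorem evalNilp₂_zero_left (F : FormalGroup A) {y : R} (hy : IsNilpotent y) : evalNilp₂ F.toPowerSeries 0 y = y := by
  have h := F.zero_add (PowerSeries.HasSubst.X (1 : Fin 2))
  have hev := congrArg (fun S : MvPowerSeries (Fin 2) A => evalNilp₂ S (0 : R) y) h
  rw [evalNilp₂_subst_pair F.toPowerSeries (map_zero _) (MvPowerSeries.constantCoeff_X 1) IsNilpotent.zero hy,
    evalNilp₂_X₁ IsNilpotent.zero hy, evalNilp₂_zero] at hev
  exact hev

/-- **`F(x, y) = F(y, x)`** on nilpotent points for a commutative law (Mathlib `FormalGroup.IsComm`). [cite: Hazewinkel1978, §1.1 (1.1.5)] -/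
theorem evalNilp₂_comm (F : FormalGroup A) [F.IsComm] {x y : R} (hx : IsNilpotent x) (hy : IsNilpotent y) :
    evalNilp₂ F.toPowerSeries x y = evalNilp₂ F.toPowerSeries y x := by
  have h := F.comm' (PowerSeries.HasSubst.X (0 : Fin 2)) (PowerSeries.HasSubst.X (1 : Fin 2))
  -- `F(X₀, X₁) = F(X₁, X₀)`; evaluate at `(x, y)`
  have hev := congrArg (fun S : MvPowerSeries (Fin 2) A => evalNilp₂ S x y) h
  rw [evalNilp₂_subst_pair F.toPowerSeries (MvPowerSeries.constantCoeff_X 0) (MvPowerSeries.constantCoeff_X 1) hx hy,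
    evalNilp₂_subst_pair F.toPowerSeries (MvPowerSeries.constantCoeff_X 1) (MvPowerSeries.constantCoeff_X 0) hx hy,
    evalNilp₂_X₀ hx hy, evalNilp₂_X₁ hx hy] at hev
  exact hev

/-- **`F(x, ι_F(x)) = 0`**: the inverse series (★ `FormalGroupNeg.negSeries`) gives inverses on nilpotent points. [cite: Hazewinkel1978, §1.1 (1.1.4)] -/
theorem evalNilp₂_negSeries_right (F : FormalGroup A) {x : R} (hx : IsNilpotent x) :
    evalNilp₂ F.toPowerSeries x (evalNilp (FormalGroupNeg.negSeries F) x) = 0 := by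
  have h := FormalGroupNeg.subst_X_negSeries F   -- `F(T, ι(T)) = 0` in `A⟦T⟧`
  have hev := congrArg (fun S : PowerSeries A => evalNilp S x) h
  simp only [evalNilp_zero] at hev
  rw [evalNilp_subst_pair F.toPowerSeries PowerSeries.constantCoeff_X (FormalGroupNeg.constantCoeff_negSeries F) hx, evalNilp_X hx] at hev
  exact hev

/-- **`F(ι_F(x), x) = 0`**. [cite: Hazewinkel1978, §1.1 (1.1.4)] -/
theorem evalNilp₂_negSeries_left (F : FormalGroup A) {x : R} (hx : IsNilpotent x) :
    evalNilp₂ F.toPowerSeries (evalNilp (FormalGroupNeg.negSeries F) x) x = 0 := by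
  have h := FormalGroupNeg.subst_negSeries_X F
  have hev := congrArg (fun S : PowerSeries A => evalNilp S x) h
  simp only [evalNilp_zero] at hev
  rw [evalNilp_subst_pair F.toPowerSeries (FormalGroupNeg.constantCoeff_negSeries F) PowerSeries.constantCoeff_X hx, evalNilp_X hx] at hev
  exact hev

/-! ## §3 Sums of homomorphisms and the `[m]`-series on points -/

namespace FormalGroupHom

variable {F G : FormalGroup A}

/-- **`(φ + ψ)(x) = G(φ(x), ψ(x))`** on nilpotent points (★ `FormalGroupHom.add`). [cite: Hazewinkel1978, §1.2 (1.2.5)] -/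
theorem evalNilp_add [G.IsComm] (φ ψ : FormalGroupHom F G) {x : R} (hx : IsNilpotent x) :
    evalNilp (φ.add ψ).toPowerSeries x = evalNilp₂ G.toPowerSeries (evalNilp φ.toPowerSeries x) (evalNilp ψ.toPowerSeries x) := by
  rw [add_toPowerSeries, evalNilp_subst_pair G.toPowerSeries φ.constantCoeff_eq_zero ψ.constantCoeff_eq_zero hx]

/-- `[0]_F(x) = 0`. [cite: Hazewinkel1978, §1.2 (1.2.4)] -/
theorem evalNilp_nsmulHom_zero [F.IsComm] (x : R) : evalNilp (nsmulHom F 0).toPowerSeries x = 0 := by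
  rw [nsmulHom_zero, zero_toPowerSeries, evalNilp_zero]

/-- **`[m+1]_F(x) = F([m]_F(x), x)`** on nilpotent points. [cite: Hazewinkel1978, §1.2 (1.2.4)] -/
theorem evalNilp_nsmulHom_succ [F.IsComm] (m : ℕ) {x : R} (hx : IsNilpotent x) :
    evalNilp (nsmulHom F (m + 1)).toPowerSeries x = evalNilp₂ F.toPowerSeries (evalNilp (nsmulHom F m).toPowerSeries x) x := by
  rw [nsmulHom_succ, evalNilp_add _ _ hx, id_toPowerSeries, evalNilp_X hx]

/-- `[1]_F(x) = x`. [cite: Hazewinkel1978, §1.2 (1.2.4)] -/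
theorem evalNilp_nsmulHom_one [F.IsComm] {x : R} (hx : IsNilpotent x) : evalNilp (nsmulHom F 1).toPowerSeries x = x := by
  rw [nsmulHom_one, id_toPowerSeries, evalNilp_X hx]

end FormalGroupHom

end Literature.RingTheory.FormalGroups
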